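import Literature.Topology.FourManifolds.CircleNbhdOfFraming
import Literature.Topology.FourManifolds.SphereFamilySurgery
import HarnessLib

/-!
# Framed tubes along normally framed embedded compact manifolds (exponential substitute + IFT)

Topic `Literature/Topology/FourManifolds` (infrastructure for the fact seat of
`Literature.Topology.FourManifolds.HomotopySphere.exists_highlyConnected_of_mem_signatureSet`,
brick B8-T: the tubular-neighbourhood step of Kosinski X.(2.1)).  A. Kosinski, *Differential
Manifolds* (1993), III, Thm. (2.2) and Cor. (2.3): an embedded closed submanifold with
trivialised normal bundle has a product neighbourhood `M × ℝᵐ ↪ X` — here for an ABSTRACT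
ambient manifold `X` (charted on its model vector space `E`), generalising the tree's
`nonempty_circleNbhd_of_isSmoothAlong` (`CircleNbhdOfFraming.lean`, circles in `4`-manifolds)
verbatim to any compact boundaryless source `M`, any fibre `F` and any `E`:

* `mfderiv_tube_zero'` — the differential of a tube map `G : M × F → X` at the zero section is
  `dc ⊕ N` when `G (x, 0) = c x` and the fibre derivative at `(x, 0)` is `N x`;
* `exists_isSmoothEmbedding_tube_of_isSmoothAlong` — **framed tubular neighbourhood theorem**:
  for `c : M → X` smooth and injective (`M` compact) and a field `N x : F →L T_{c x} X` smooth
  along `c` with `dc_x ⊕ N x` bijective for all `x`, there is a `C^∞` embedding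
  `ν : M × F → X` with open range and `ν (x, 0) = c x` (tube map of `exists_tube_of_isSmoothAlong`,
  inverse function theorem `isLocalDiffeomorphAt_of_mfderiv`, uniform tube by compactness,
  injectivity by `exists_injOn_prod_ball_of_continuousAt`, fibre squeezed by `prodUnivBall`,
  `isSmoothEmbedding_of_isLocalDiffeomorph`);
* `exists_framedSphereFamily_of_isSmoothAlong` — the case `M = Sᵏ`, `F = ℝᵐ`, `E = ℝⁿ⁺¹`,
  packaged as a one-member `FramedSphereFamily (𝓡 (n+1)) X Unit k m` with prescribed core.

Everything is proved; no definitions, no named facts.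

## References

* A. Kosinski, *Differential Manifolds* (1993), III §2, Thm. (2.2), Cor. (2.3); I.(7.2).
  [Kosinski1993]
* M. W. Hirsch, *Differential Topology* (1976), Ch. 4 §5, Thm. 5.1 (proof). [HirschDT1976]
* J. M. Lee, *Introduction to Smooth Manifolds* (2013), Thm. 4.5, Prop. 4.8, Prop. 5.2.
  [LeeSmoothManifolds2013]
-/

open scoped Manifold ContDiff Topology
open Set Function Filter Metric

noncomputable section

namespace Literature.Topology.FourManifolds

section General

variable {EM HM : Type*} [NormedAddCommGroup EM] [NormedSpace ℝ EM] [TopologicalSpace HM]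
  {IM : ModelWithCorners ℝ EM HM} {M : Type*} [TopologicalSpace M] [ChartedSpace HM M]
  {E : Type*} [NormedAddCommGroup E] [NormedSpace ℝ E] {X : Type*} [TopologicalSpace X]
  [ChartedSpace E X]
  {F : Type*} [NormedAddCommGroup F] [InnerProductSpace ℝ F]

/-- **The differential of a tube map at the zero section.** If `G : M × F → X` is `C^∞` on an
open neighbourhood `W` of the zero section, restricts to `c` on it, and its fibre derivative at
`(x, 0)` read in the chart at `c x` is `N x`, then `mfderiv G (x, 0) = (mfderiv c x).coprod (N x)`
(the total derivative is the sum of the partial derivatives, `mfderiv_prod_eq_add_apply`).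
[folklore] -/
theorem mfderiv_tube_zero' {c : M → X} {N : M → (F →L[ℝ] E)} {G : M × F → X}
    {W : Set (M × F)} (hWo : IsOpen W) (hW0 : ∀ x, (x, (0 : F)) ∈ W)
    (hGW : ContMDiffOn (IM.prod 𝓘(ℝ, F)) 𝓘(ℝ, E) ∞ G W) (hG0 : ∀ x, G (x, 0) = c x)
    (hGd : ∀ x, HasFDerivAt (fun v : F => extChartAt 𝓘(ℝ, E) (c x) (G (x, v))) (N x) 0)
    (x : M) :
    mfderiv (IM.prod 𝓘(ℝ, F)) 𝓘(ℝ, E) G (x, 0) = (mfderiv IM 𝓘(ℝ, E) c x).coprod (N x) := by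
  have hGat : ContMDiffAt (IM.prod 𝓘(ℝ, F)) 𝓘(ℝ, E) ∞ G (x, 0) :=
    hGW.contMDiffAt (hWo.mem_nhds (hW0 x))
  have hdiff : MDifferentiableAt (IM.prod 𝓘(ℝ, F)) 𝓘(ℝ, E) G (x, 0) :=
    hGat.mdifferentiableAt (by simp)
  -- the fibre derivative as an `mfderiv`
  have hfib : HasMFDerivAt 𝓘(ℝ, F) 𝓘(ℝ, E) (fun v : F => G (x, v)) 0 (N x) := by
    refine ⟨?_, ?_⟩
    · exact hGat.continuousAt.comp (by fun_prop)
    · have h1 : writtenInExtChartAt 𝓘(ℝ, F) 𝓘(ℝ, E) 0 (fun v : F => G (x, v)) =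
          fun v : F => extChartAt 𝓘(ℝ, E) (c x) (G (x, v)) := by
        ext v
        simp only [writtenInExtChartAt, hG0, extChartAt_model_space_eq_id, PartialEquiv.refl_symm,
          PartialEquiv.refl_coe, comp_apply, id_eq]
      rw [h1, modelWithCornersSelf_coe, range_id, hasFDerivWithinAt_univ,
        extChartAt_model_space_eq_id, PartialEquiv.refl_coe, id_eq]
      exact hGd x
  have hc' : (fun z : M => G (z, 0)) = c := funext hG0
  ext1 v
  rw [mfderiv_prod_eq_add_apply hdiff, hc', hfib.mfderiv]
  rfl

variable [FiniteDimensional ℝ EM] [CompleteSpace EM] [IM.Boundaryless] [IsManifold IM ∞ M]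
  [CompactSpace M] [T2Space M] [Nonempty M]
  [IsManifold 𝓘(ℝ, E) ∞ X] [T2Space X] [FiniteDimensional ℝ F]

/-- **Framed tubular neighbourhood theorem (abstract ambient manifold)** (Kosinski 1993, III,
Thm. (2.2) and Cor. (2.3), for the trivialised normal bundle of a compact submanifold).  Given
`c : M → X` smooth and injective on the compact boundaryless `M`, and linear maps
`N x : F →L T_{c x} X` smooth along `c` with `dc_x ⊕ N x` bijective, take the tube map
`G : M × F → X` of `exists_tube_of_isSmoothAlong` (`G (x, 0) = c x`, fibre derivative `N x`):
its differential at the zero section is `dc_x ⊕ N x` (`mfderiv_tube_zero'`), invertible, so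
`G` is a local diffeomorphism near the zero section (inverse function theorem on manifolds), on a
uniform tube `M × B(0, ε)` by compactness, and injective on a smaller tube since it is injective
on the zero section (`exists_injOn_prod_ball_of_continuousAt`, Kosinski I.(7.2)); squeezing
`F ≅ B(0, ε)` (`prodUnivBall`) gives an injective local diffeomorphism `M × F → X`, i.e.
(`isSmoothEmbedding_of_isLocalDiffeomorph`) a `C^∞` open embedding restricting to `c` on the
zero section. [cite: Kosinski1993, Ch. III §2, Thm. (2.2) and Cor. (2.3)] -/
theorem exists_isSmoothEmbedding_tube_of_isSmoothAlong {c : M → X}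
    (hc : ContMDiff IM 𝓘(ℝ, E) ∞ c) (hci : Injective c) {N : M → (F →L[ℝ] E)}
    (hN : IsSmoothAlong IM c N)
    (hbij : ∀ x : M, Bijective ((mfderiv IM 𝓘(ℝ, E) c x).coprod (N x))) :
    ∃ ν : M × F → X, Manifold.IsSmoothEmbedding (IM.prod 𝓘(ℝ, F)) 𝓘(ℝ, E) ∞ ν ∧
      IsOpen (range ν) ∧ ∀ x, ν (x, 0) = c x := by
  -- the tube map
  obtain ⟨G, ⟨W, hWo, hW0, hGW⟩, hG0, hGd⟩ := exists_tube_of_isSmoothAlong (IM := IM) (F := F) hc hN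
  have hGd' : ∀ x, HasFDerivAt (fun v : F => extChartAt 𝓘(ℝ, E) (c x) (G (x, v))) (N x) 0 :=
    fun x => by simpa only [frameIn_self] using hGd x (c x) (mem_chart_source _ (c x))
  -- the linear model `EM × F ≃L E`
  obtain ⟨x₀⟩ := ‹Nonempty M›
  let L : (EM × F) ≃L[ℝ] E :=
    (LinearEquiv.ofBijective
      (show (EM × F) →ₗ[ℝ] E from ((mfderiv IM 𝓘(ℝ, E) c x₀).coprod (N x₀)).toLinearMap)
      (by exact hbij x₀)).toContinuousLinearEquiv
  -- local diffeomorphism at the zero section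
  have hloc0 : ∀ x : M, IsLocalDiffeomorphAt (IM.prod 𝓘(ℝ, F)) 𝓘(ℝ, E) ∞ G (x, 0) := by
    intro x
    let L₀ : (EM × F) →ₗ[ℝ] E :=
      show (EM × F) →ₗ[ℝ] E from ((mfderiv IM 𝓘(ℝ, E) c x).coprod (N x)).toLinearMap
    have hb : Bijective L₀ := by exact hbij x
    let Lx : (EM × F) ≃L[ℝ] E := (LinearEquiv.ofBijective L₀ hb).toContinuousLinearEquiv
    refine isLocalDiffeomorphAt_of_mfderiv hWo (hW0 x) hGW (by simp) Lx ?_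
    rw [mfderiv_tube_zero' hWo hW0 hGW hG0 hGd' x]
    rfl
  -- a uniform tube of local diffeomorphisms
  obtain ⟨ε₁, hε₁, hloc⟩ : ∃ ε₁ > 0, ∀ q : M × F, q.2 ∈ ball (0 : F) ε₁ →
      IsLocalDiffeomorphAt (IM.prod 𝓘(ℝ, F)) 𝓘(ℝ, E) ∞ G q := by
    have hopen := isOpen_setOf_isLocalDiffeomorphAt (I := IM.prod 𝓘(ℝ, F)) (J := 𝓘(ℝ, E))
      (n := ∞) G
    have hsub : (univ : Set M) ×ˢ ({0} : Set F) ⊆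
        {q | IsLocalDiffeomorphAt (IM.prod 𝓘(ℝ, F)) 𝓘(ℝ, E) ∞ G q} := by
      rintro ⟨x, v⟩ ⟨-, hv⟩
      rw [mem_singleton_iff] at hv
      subst hv
      exact hloc0 x
    obtain ⟨U, V, -, hV, hU, h0V, hUV⟩ :=
      generalized_tube_lemma isCompact_univ isCompact_singleton hopen hsub
    obtain ⟨ε, hε, hball⟩ := Metric.isOpen_iff.1 hV 0 (h0V rfl)
    exact ⟨ε, hε, fun q hq => hUV ⟨hU (mem_univ _), hball hq⟩⟩
  -- injectivity on a uniform tube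
  obtain ⟨ε₂, hε₂, hinjOn⟩ : ∃ ε₂ > 0, InjOn G ((univ : Set M) ×ˢ ball (0 : F) ε₂) := by
    refine exists_injOn_prod_ball_of_continuousAt (fun x => ?_) ?_ fun x => ?_
    · exact (hGW.contMDiffAt (hWo.mem_nhds (hW0 x))).continuousAt
    · intro x y hxy
      simp only [hG0] at hxy
      exact hci hxy
    · obtain ⟨Φ, hx, heq⟩ := hloc0 x
      exact ⟨Φ.source, Φ.open_source.mem_nhds hx, fun a ha b hb hab =>
        Φ.injOn ha hb (by rwa [← heq ha, ← heq hb])⟩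
  -- the squeezed tube map
  have hε : 0 < min ε₁ ε₂ := lt_min hε₁ hε₂
  set ν : M × F → X :=
    fun q => G (q.1, OpenPartialHomeomorph.univBall (0 : F) (min ε₁ ε₂) q.2) with hν
  have hb := univBall_mem_ball (F := F) hε
  have hld : IsLocalDiffeomorph (IM.prod 𝓘(ℝ, F)) 𝓘(ℝ, E) ∞ ν := by
    intro q
    have h1 := isLocalDiffeomorphAt_prodUnivBall (I := IM) (M := M) (F := F) hε q
    have h2 := hloc (q.1, OpenPartialHomeomorph.univBall (0 : F) (min ε₁ ε₂) q.2)
      (ball_subset_ball (min_le_left _ _) (hb q.2))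
    exact h1.comp (K := 𝓘(ℝ, E)) (P := X) h2
  have hinj : Injective ν := by
    rintro ⟨x, v⟩ ⟨y, w⟩ hq
    have hq' : G (x, OpenPartialHomeomorph.univBall (0 : F) (min ε₁ ε₂) v) =
        G (y, OpenPartialHomeomorph.univBall (0 : F) (min ε₁ ε₂) w) := hq
    have := @hinjOn (x, OpenPartialHomeomorph.univBall (0 : F) (min ε₁ ε₂) v)
      ⟨mem_univ x, ball_subset_ball (min_le_right _ _) (hb v)⟩
      (y, OpenPartialHomeomorph.univBall (0 : F) (min ε₁ ε₂) w)
      ⟨mem_univ y, ball_subset_ball (min_le_right _ _) (hb w)⟩ hq'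
    obtain ⟨hxy, hvw⟩ := Prod.mk.inj this
    rw [hxy, univBall_injective _ hvw]
  exact ⟨ν, isSmoothEmbedding_of_isLocalDiffeomorph hld hinj L, hld.isOpen_range, fun x => by
    simp only [hν, OpenPartialHomeomorph.univBall_apply_zero, hG0]⟩

end General

/-! ### Spheres: a one-member framed sphere family with prescribed core -/

section Sphere

variable {n k m : ℕ} {X : Type*} [TopologicalSpace X] [T2Space X]
  [ChartedSpace (EuclideanSpace ℝ (Fin (n + 1))) X] [IsManifold (𝓡 (n + 1)) ∞ X]

/-- **A normally framed embedded sphere has a product neighbourhood** `Sᵏ × ℝᵐ ↪ X`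
(Kosinski 1993, III Cor. (2.3) with the framing; the geometric half of X.(2.1), p. 200: "`φ`
imbeds `Sᵏ × Dᵐ`"), packaged as a one-member `FramedSphereFamily` whose core sphere is the given
embedding `c`. [cite: Kosinski1993, Ch. III §2, Cor. (2.3); Ch. X §2, Lemma (2.1)] -/
theorem exists_framedSphereFamily_of_isSmoothAlong
    {c : Metric.sphere (0 : EuclideanSpace ℝ (Fin (k + 1))) 1 → X}
    (hc : ContMDiff (𝓡 k) (𝓡 (n + 1)) ∞ c) (hci : Injective c)
    {N : Metric.sphere (0 : EuclideanSpace ℝ (Fin (k + 1))) 1 →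
      (EuclideanSpace ℝ (Fin m) →L[ℝ] EuclideanSpace ℝ (Fin (n + 1)))}
    (hN : IsSmoothAlong (𝓡 k) c N)
    (hbij : ∀ u, Bijective ((mfderiv (𝓡 k) (𝓡 (n + 1)) c u).coprod (N u))) :
    ∃ ν : FramedSphereFamily (𝓡 (n + 1)) X Unit k m, ∀ u, ν.toFun () (u, 0) = c u := by
  haveI : Nonempty (Metric.sphere (0 : EuclideanSpace ℝ (Fin (k + 1))) 1) :=
    ⟨⟨EuclideanSpace.single 0 1, by simp⟩⟩
  obtain ⟨ν, hν, hνo, hν0⟩ := exists_isSmoothEmbedding_tube_of_isSmoothAlong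
    (IM := 𝓡 k) (F := EuclideanSpace ℝ (Fin m)) hc hci hN hbij
  exact ⟨{ toFun := fun _ => ν
           isSmoothEmbedding := fun _ => hν
           isOpen_range := fun _ => hνo
           disjoint_range := fun i j hij => absurd (Subsingleton.elim i j) hij }, hν0⟩

end Sphere

end Literature.Topology.FourManifolds
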